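import Summits.NavierStokesRegularity.NavierStokesRegularity.Theses.CertifiedBlowup
import Summits.NavierStokesRegularity.NavierStokesRegularity.Theorems.CertifiedBlowupRateGlue
import Literature.Analysis.FluidPDE.DynamicRescalingRate
import Literature.Analysis.FluidPDE.VorticityBlowupMaximal

/-!
# Route CertifiedBlowup — the rate class `#3` from the output of a dynamic-rescaling certificate

Support file for the informal item stmt-NavierStokesRegularity-0269 (`certifiedBlowup_analytic`,
"certificate ⇒ blow-up") and crux #3 `CertifiedBlowupVorticityRateBlowup` (stmt-…-8639).
The thesis asserts informally that "any Chen–Hou-type certificate with bounded rescaled profile and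
`c_ω < 0` delivers" the rate class `(T − t)‖ω(t)‖_∞ ≤ C`.  This file is the typed form of that
transfer, with NO reference to the (still undefined) canonical stability frame: it isolates exactly
what the analytic nonlinear-stability theorem of a certified Navier–Stokes blow-up has to output in
physical variables —

* a classical solution `(u, p)` of Navier–Stokes (`ν > 0`, `f = 0`) on `ℝ³ × [0, T)` with
  `T = t(∞) = blowupTime (rescalingFactor c_ω)` the blow-up time of the dynamic-rescaling clock
  `t(τ) = ∫₀^τ C_ω`, `C_ω = exp ∫₀^τ c_ω`, Leray–Hopf on `[0, T)`, from a rapidly decaying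
  axisymmetric datum;
* an exponent pinched below zero, `c_ω(τ) ≤ −a < 0` for `τ ≥ 0`;
* a rescaled vorticity profile `ω̃(τ) = C_ω(τ) ω(t(τ))` that stays BOUNDED (`≤ M` everywhere) and
  NONTRIVIAL at points of a bounded region `Ω` (`≥ m > 0`),

— and proves that these outputs give `CertifiedBlowupVorticityRateBlowup` verbatim
(`certifiedBlowupVorticityRateBlowup_of_rescaling`), hence `CertifiedBlowupAxisymBlowup`
(`certifiedBlowupAxisymBlowup_of_rescaling`, through the proved `CertifiedBlowupRateGlue`).
Ingredients (Literature, proved): `isMaximalSmoothSolution_of_rescaling`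
(`VorticityBlowupMaximal.lean`: nontrivial rescaled vorticity in a bounded region ⇒ vorticity
blow-up at `T` ⇒ no classical continuation) and `vorticityRate_of_rescaling`
(`DynamicRescalingRate.lean`: `C_ω(τ) ≥ a (T − t(τ))`, so a bounded profile is vorticity-Type-I).
-/

-- the summit and its single sub-problem share the name (CONVENTIONS §1), as in every Theorems file
set_option linter.dupNamespace false

namespace Summit.NavierStokesRegularity.NavierStokesRegularity.Theorems

open Set Filter Bornology
open Literature.Analysis.FluidPDE
open Summit.NavierStokesRegularity.NavierStokesRegularity.Theses.CertifiedBlowup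

/-- **The certificate class from dynamic-rescaling outputs.** Let `ν > 0`, let the exponent
`c = c_ω` be continuous with `c(τ) ≤ −a < 0` for `τ ≥ 0`, and put `C = rescalingFactor c`,
`t = rescaledTime C`, `T = blowupTime C`. If `(u, p)` is a classical Navier–Stokes solution on
`[0, T)`, Leray–Hopf on `[0, T)`, with `u 0` rapidly decaying and axisymmetric, whose rescaled
vorticity `C(τ) ‖curl u(t(τ), x)‖` is bounded by `M` for all `τ ≥ 0`, `x`, and bounded below by
`m > 0` at some point of a bounded region `Ω` for all large `τ`, then
`CertifiedBlowupVorticityRateBlowup` holds, with witness `(ν, T, u, p)` and rate constant `M / a`.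
[folklore] -/
theorem certifiedBlowupVorticityRateBlowup_of_rescaling {ν : ℝ} (hν : 0 < ν) {c : ℝ → ℝ}
    (hc : Continuous c) {a : ℝ} (ha : 0 < a) (hca : ∀ s, 0 ≤ s → c s ≤ -a)
    {u : ℝ → EuclideanSpace ℝ (Fin 3) → EuclideanSpace ℝ (Fin 3)}
    {p : ℝ → EuclideanSpace ℝ (Fin 3) → ℝ}
    (hcl : IsClassicalNSSolutionOn (Ico 0 (blowupTime (rescalingFactor c))) ν 0 u p)
    (hLH : IsLerayHopfOn (blowupTime (rescalingFactor c)) ν 0 (u 0) u)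
    (hdec : HasRapidSpatialDecay (u 0)) (hax : IsAxisymmetric (u 0))
    {Ω : Set (EuclideanSpace ℝ (Fin 3))} (hΩ : IsBounded Ω) {m : ℝ} (hm : 0 < m)
    (hlow : ∀ᶠ τ in atTop, ∃ x ∈ Ω,
      m ≤ rescalingFactor c τ * ‖curl (u (rescaledTime (rescalingFactor c) τ)) x‖)
    {M : ℝ} (hM : ∀ τ, 0 ≤ τ → ∀ x : EuclideanSpace ℝ (Fin 3),
      rescalingFactor c τ * ‖curl (u (rescaledTime (rescalingFactor c) τ)) x‖ ≤ M) :
    CertifiedBlowupVorticityRateBlowup := by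
  unfold CertifiedBlowupVorticityRateBlowup
  have hC := continuous_rescalingFactor hc
  have hpos := rescalingFactor_pos c
  have hint := integrableOn_rescalingFactor hc ha hca
  exact ⟨ν, hν, blowupTime (rescalingFactor c), blowupTime_pos hC hpos hint, u, p,
    isMaximalSmoothSolution_of_rescaling hC hpos hint hΩ hm hlow hcl, hLH, hdec, hax,
    vorticityRate_of_rescaling hc ha hca hM⟩

/-- The same outputs give the bare axisymmetric blow-up `CertifiedBlowupAxisymBlowup` (crux #2),
through the proved glue `CertifiedBlowupRateGlue` (`certifiedBlowup_rateGlue_proof`). [folklore] -/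
theorem certifiedBlowupAxisymBlowup_of_rescaling {ν : ℝ} (hν : 0 < ν) {c : ℝ → ℝ}
    (hc : Continuous c) {a : ℝ} (ha : 0 < a) (hca : ∀ s, 0 ≤ s → c s ≤ -a)
    {u : ℝ → EuclideanSpace ℝ (Fin 3) → EuclideanSpace ℝ (Fin 3)}
    {p : ℝ → EuclideanSpace ℝ (Fin 3) → ℝ}
    (hcl : IsClassicalNSSolutionOn (Ico 0 (blowupTime (rescalingFactor c))) ν 0 u p)
    (hLH : IsLerayHopfOn (blowupTime (rescalingFactor c)) ν 0 (u 0) u)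
    (hdec : HasRapidSpatialDecay (u 0)) (hax : IsAxisymmetric (u 0))
    {Ω : Set (EuclideanSpace ℝ (Fin 3))} (hΩ : IsBounded Ω) {m : ℝ} (hm : 0 < m)
    (hlow : ∀ᶠ τ in atTop, ∃ x ∈ Ω,
      m ≤ rescalingFactor c τ * ‖curl (u (rescaledTime (rescalingFactor c) τ)) x‖)
    {M : ℝ} (hM : ∀ τ, 0 ≤ τ → ∀ x : EuclideanSpace ℝ (Fin 3),
      rescalingFactor c τ * ‖curl (u (rescaledTime (rescalingFactor c) τ)) x‖ ≤ M) :
    CertifiedBlowupAxisymBlowup :=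
  certifiedBlowup_rateGlue_proof
    (certifiedBlowupVorticityRateBlowup_of_rescaling hν hc ha hca hcl hLH hdec hax hΩ hm hlow hM)

end Summit.NavierStokesRegularity.NavierStokesRegularity.Theorems
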